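import Mathlib

/-!
# Crux `RamseyUncertifiable.ResolutionUncertainty` (stmt-PneNP-9816), line
# `jukna-game-monotone-interpolation`: the depth-2 (DNF) case of the shadow lower bound

Support lemma for the line's monotone engine `ShadowLowerBound` (a sufficient criterion for the
registered rich-case stub, see `Cruxes/ResolutionUncertainty/NOTES.md` § ENGINE). A monotone DNF that
accepts every clique of a family `ext` of vertex sets inside `A` and rejects the *shadow*
`A ∩ N(y)` of every `kB`-clique `y ⊆ B` is a family `terms` of vertex sets such that every member of
`ext` contains a term and no term lies inside a shadow. We prove the covering lower bound
`#terms ≥ n ^ (c · (ℓ₀ + 1 - kB))` from the two hypotheses of a rich split that the engine would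
consume: (`hreg`, one-sided log-scale regularity) every `S ⊆ A ∪ B` with `#S < ℓ₀` has a common
neighbour in `B`; (`hspread`) the family `ext` is `n ^ c`-spread. Proof: a term `T` with
`#T + kB ≤ ℓ₀` extends greedily (`exists_clique_complete_to`) to a `kB`-clique `y ⊆ B` complete to
`T`, so `T` lies in the shadow of `y` — excluded; hence every useful term has `> ℓ₀ - kB` vertices
and, by spreadness, covers at most an `n ^ (-c (ℓ₀ + 1 - kB))` fraction of `ext`. With the rich-split
parameters `ℓ₀ = ⌊(1-2η) log₂ n⌋`, `kB ≤ (1-η)/2 · log₂ n` this is `n ^ {c (1-3η)/2 · log₂ n}`: DNF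
separators are quasi-polynomial, as the engine predicts for all monotone circuits. [folklore
counting; the statement is the lead's, 2026-08-16]
-/

-- `Summit.PneNP.PneNP.…` repeats `PneNP` by the tree's layout (summit = problem); silence the core linter as the landed siblings do.
set_option linter.dupNamespace false

namespace Summit.PneNP.PneNP.Theorems.RamseyUncertifiableResolutionUncertainty

open Finset

variable {n : ℕ}

/-- **Greedy cliques inside common neighbourhoods.** If every `S ⊆ A ∪ B` with fewer than `ℓ₀`
vertices has a common neighbour in `B`, then every `T ⊆ A ∪ B` with `#T + j ≤ ℓ₀` has a `j`-clique
`y ⊆ B` all of whose vertices are adjacent to all of `T` (so `T` lies in the shadow of `y`). -/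
theorem exists_clique_complete_to (H : SimpleGraph (Fin n)) [DecidableRel H.Adj]
    (A B : Finset (Fin n)) (ℓ₀ : ℕ)
    (hreg : ∀ S ⊆ A ∪ B, S.card < ℓ₀ → ∃ w ∈ B, ∀ u ∈ S, H.Adj w u)
    (T : Finset (Fin n)) (hT : T ⊆ A ∪ B) :
    ∀ j : ℕ, T.card + j ≤ ℓ₀ →
      ∃ y : Finset (Fin n), y ⊆ B ∧ H.IsNClique j y ∧ ∀ w ∈ y, ∀ u ∈ T, H.Adj w u := by
  intro j
  induction j with
  | zero =>
    intro _
    exact ⟨∅, empty_subset _, SimpleGraph.isNClique_empty.mpr rfl, by simp⟩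
  | succ j ih =>
    intro hj
    obtain ⟨y, hyB, hy, hyT⟩ := ih (by omega)
    have hS : T ∪ y ⊆ A ∪ B := union_subset hT (hyB.trans subset_union_right)
    have hcard : (T ∪ y).card < ℓ₀ :=
      lt_of_le_of_lt (card_union_le _ _) (by rw [hy.card_eq]; omega)
    obtain ⟨w, hwB, hw⟩ := hreg _ hS hcard
    refine ⟨insert w y, insert_subset hwB hyB,
      hy.insert fun b hb => hw b (mem_union_right _ hb), ?_⟩
    intro w' hw' u hu
    rcases mem_insert.1 hw' with rfl | hw'y
    · exact hw u (mem_union_left _ hu)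
    · exact hyT w' hw'y u hu

/-- **Useful terms are long.** Under `hreg`, a vertex set `T ⊆ A ∪ B` that lies in no shadow of a
`kB`-clique of `B` has more than `ℓ₀ - kB` vertices. -/
theorem card_gt_of_not_subset_shadow (H : SimpleGraph (Fin n)) [DecidableRel H.Adj]
    (A B : Finset (Fin n)) (kB ℓ₀ : ℕ)
    (hreg : ∀ S ⊆ A ∪ B, S.card < ℓ₀ → ∃ w ∈ B, ∀ u ∈ S, H.Adj w u)
    (T : Finset (Fin n)) (hTA : T ⊆ A)
    (hsafe : ∀ y : Finset (Fin n), y ⊆ B → H.IsNClique kB y →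
      ¬ T ⊆ A.filter fun v => ∀ w ∈ y, H.Adj v w) :
    ℓ₀ + 1 - kB ≤ T.card := by
  by_contra hlt
  have hle : T.card + kB ≤ ℓ₀ := by omega
  obtain ⟨y, hyB, hy, hyT⟩ :=
    exists_clique_complete_to H A B ℓ₀ hreg T (hTA.trans subset_union_left) kB hle
  refine hsafe y hyB hy fun v hv => ?_
  rw [mem_filter]
  exact ⟨hTA hv, fun w hw => (hyT w hw v hv).symm⟩

/-- **Depth-2 case of the shadow lower bound (DNF separators need `n ^ Ω(log n)` terms).**
Let `ext` be a non-empty `n ^ c`-spread family of vertex sets inside `A` (`hspread`: for every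
non-empty `S ⊆ A`, at most an `n ^ (-c #S)` fraction of `ext` contains `S`), and let `terms` be a
family such that every member of `ext` contains some term (`hcover`, the DNF accepts the positives)
and no term lies in the shadow `A ∩ N(y)` of a `kB`-clique `y ⊆ B` (`hsafe`, the DNF rejects the
negatives). If every `S ⊆ A ∪ B` with `#S < ℓ₀` has a common neighbour in `B` (`hreg`) and
`kB ≤ ℓ₀`, then `#terms ≥ n ^ (c (ℓ₀ + 1 - kB))`. -/
theorem shadow_dnf_cover_lower_bound :
    ∀ {n : ℕ} (H : SimpleGraph (Fin n)) [DecidableRel H.Adj] (A B : Finset (Fin n)) (kB ℓ₀ : ℕ) (c : ℝ)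
      (ext terms : Finset (Finset (Fin n))), 1 ≤ n → 0 ≤ c → kB ≤ ℓ₀ → ext.Nonempty →
      (∀ S ⊆ A ∪ B, S.card < ℓ₀ → ∃ w ∈ B, ∀ u ∈ S, H.Adj w u) →
      (∀ S ⊆ A, S.Nonempty →
        (((ext.filter fun x => S ⊆ x).card : ℝ) * (n : ℝ) ^ (c * S.card)) ≤ ext.card) →
      (∀ x ∈ ext, x ⊆ A) → (∀ x ∈ ext, ∃ T ∈ terms, T ⊆ x) →
      (∀ T ∈ terms, ∀ y : Finset (Fin n), y ⊆ B → H.IsNClique kB y →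
        ¬ T ⊆ A.filter fun v => ∀ w ∈ y, H.Adj v w) →
      (n : ℝ) ^ (c * ((ℓ₀ + 1 - kB : ℕ) : ℝ)) ≤ terms.card := by
  intro n H _ A B kB ℓ₀ c ext terms hn hc hkB hne hreg hspread hextA hcover hsafe
  set m₀ : ℕ := ℓ₀ + 1 - kB with hm₀
  set p : ℝ := (n : ℝ) ^ (c * (m₀ : ℝ)) with hp
  have hn1 : (1 : ℝ) ≤ n := by exact_mod_cast hn
  have hp0 : 0 < p := Real.rpow_pos_of_pos (by linarith) _
  have hE0 : (0 : ℝ) < ext.card := by exact_mod_cast hne.card_pos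
  -- each term covers at most `#ext / p` members of `ext`
  have hterm : ∀ T ∈ terms, ((ext.filter fun x => T ⊆ x).card : ℝ) ≤ ext.card / p := by
    intro T hT
    by_cases huse : (ext.filter fun x => T ⊆ x).Nonempty
    · obtain ⟨x, hx⟩ := huse
      rw [mem_filter] at hx
      have hTA : T ⊆ A := hx.2.trans (hextA x hx.1)
      have hcardT : m₀ ≤ T.card :=
        card_gt_of_not_subset_shadow H A B kB ℓ₀ hreg T hTA (hsafe T hT)
      have hTne : T.Nonempty := card_pos.1 (by omega)
      have hsp := hspread T hTA hTne
      have hpow : p ≤ (n : ℝ) ^ (c * T.card) :=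
        Real.rpow_le_rpow_of_exponent_le hn1
          (mul_le_mul_of_nonneg_left (by exact_mod_cast hcardT) hc)
      rw [le_div_iff₀ hp0]
      calc ((ext.filter fun x => T ⊆ x).card : ℝ) * p
          ≤ ((ext.filter fun x => T ⊆ x).card : ℝ) * (n : ℝ) ^ (c * T.card) :=
            mul_le_mul_of_nonneg_left hpow (by positivity)
        _ ≤ ext.card := hsp
    · rw [not_nonempty_iff_eq_empty.1 huse, card_empty, Nat.cast_zero]
      positivity
  -- every member of `ext` is covered by some term
  have hcov : ext ⊆ terms.biUnion fun T => ext.filter fun x => T ⊆ x := by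
    intro x hx
    obtain ⟨T, hT, hTx⟩ := hcover x hx
    exact mem_biUnion.2 ⟨T, hT, mem_filter.2 ⟨hx, hTx⟩⟩
  have hsum : (ext.card : ℝ) ≤ terms.card * (ext.card / p) := by
    calc (ext.card : ℝ)
        ≤ ((terms.biUnion fun T => ext.filter fun x => T ⊆ x).card : ℝ) := by
          exact_mod_cast card_le_card hcov
      _ ≤ ∑ T ∈ terms, ((ext.filter fun x => T ⊆ x).card : ℝ) := by
          exact_mod_cast card_biUnion_le
      _ ≤ ∑ _T ∈ terms, (ext.card : ℝ) / p := sum_le_sum hterm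
      _ = terms.card * (ext.card / p) := by rw [sum_const, nsmul_eq_mul]
  -- clear denominators: `#ext · p ≤ #ext · #terms`, then cancel `#ext > 0`
  have h1 : (ext.card : ℝ) * p ≤ ext.card * terms.card := by
    have h := mul_le_mul_of_nonneg_right hsum hp0.le
    calc (ext.card : ℝ) * p ≤ terms.card * (ext.card / p) * p := h
      _ = ext.card * terms.card := by field_simp
  exact le_of_mul_le_mul_left h1 hE0

end Summit.PneNP.PneNP.Theorems.RamseyUncertifiableResolutionUncertainty
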